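import Summits.ABC.IUTFork.Cor312GenuineKWildExact
import Summits.ABC.IUTFork.Cor312GenuineKWildDifferentUnit
import HarnessLib

/-!
# [IUTchIII] Cor. 3.12, branch C / R-W window table — the EXACT wild local type at a W2 packet:
# `e(K_{x₀}/ℚ_p) = p·(p − 1)·(p′/gcd(p′, t))·l` at every fibre point `x₀ ∣ p ∈ {3, 5}` over a pole of `j` of order `2t` with
# `p ∣ t` and the unit criterion `u^{p−1} ≢ 1 (mod p²)` (`{p, p′} = {3, 5}`, `p ≠ l`)

PROOF-ONLY support file (D-0012; 0 definitions, 0 `Prop` facts) of the abc-iut cell (R-W «WINDOW Θ-SIDE INEQUALITY», seat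
abc-iut-W-neg-1 gen 2; GAP G-Wnum2-1 (i), type W2 of abc-iut W-num-2's N1-WILD-EXACT L5). TAKES NO SIDE on [IUTchIII] Cor. 3.12
(S. Mochizuki, *Inter-universal Teichmüller theory III*, Cor. 3.12 p. 173–174) or on any author.

Sequel of `Cor312GenuineKWildExact` (type W1, `p ∤ t`): at a W2 packet the wild factor `p ∣ e` comes from the unit radical
`u^{1/p} ∈ K_{x₀}` (`GenuineK.prime_dvd_absRamificationIdx_kOf_wildUnit_ratPoint`, Hecke's criterion) instead of from the
`30`-th root of the Tate parameter; the other three inputs are unchanged — `(p−1) ∣ e(w|p)` (`μ₃₀ ⊂ F`), `15 ∣ e(w|p)·t`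
(Tate root), `e(w|p) ∣ p(p−1)p′` resp. `∣ p(p−1)` when `p′ ∣ t` (`Cor22.ramificationIdx_subThetaField_dvd_wild`, Serre 1972 §1.12):

* **`GenuineK.absRamificationIdx_kOf_eq_wildUnit_ratPoint`** — **`e(K_{x₀}/ℚ_p) = p·(p − 1)·(p′/gcd(p′, t))·l`**, W-num-2's
  `e_w = l·e_W·r` with `e_W = p(p−1)` at a (non-split) W2 packet (Broberg `ℚ(√7)` at `3`, `h = 24`: `e = 30·l`).

HONEST FRAMING: bookkeeping over OUR typed objects; nothing here bears on the printed inequality of [IUTchIII] Cor. 3.12 or on the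
number-level `Cor22.Cor312AtDatum`; typed ≠ proved; instantiated ≠ endorsed.
[cite: Serre1972, §1.11–§1.12] [cite: Mochizuki2012, IUTchIV Thm. 1.10 p. 22] [cite: SerreLocalFields1979, Ch. III §6 Prop. 13]
[claim: Mochizuki2012, status: disputed] for every IUT quotation.
-/

noncomputable section

open NumberField IsDedekindDomain

namespace Summit.ABC.IUTFork.Conditional

open Thm311 Thm311.Real Cor312 Cor312Prov Literature.IUT.LogVolume Literature.IUT.HodgeTheaters
  Literature.IUT.LogThetaLattice Literature.NumberTheory.NumberFields Literature.NumberTheory.DiophantineGeometry.GenEll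
  Literature.NumberTheory.DiophantineGeometry

/-- The arithmetic of the two bounds with the wild factor given: `(p−1) ∣ A`, `p ∣ A`, `15 ∣ A·t`, `A ∣ p(p−1)p′` (and
`A ∣ p(p−1)` when `p′ ∣ t`) force `A = p(p−1)·p′/gcd(p′, t)` for `{p, p′} = {3, 5}`. [folklore] -/
private theorem wild_index_eq' {p q t A : ℕ} (hpq : (p = 3 ∧ q = 5) ∨ (p = 5 ∧ q = 3)) (hpA : p ∣ A)
    (h1 : (p - 1) ∣ A) (h15 : 15 ∣ A * t) (hup : A ∣ p * (p - 1) * q) (hup' : q ∣ t → A ∣ p * (p - 1)) :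
    A = p * (p - 1) * (q / Nat.gcd q t) := by
  rcases hpq with ⟨rfl, rfl⟩ | ⟨rfl, rfl⟩
  · have h2 : 2 ∣ A := by simpa using h1
    have h6 : 6 ∣ A := Nat.Coprime.mul_dvd_of_dvd_of_dvd (by norm_num) h2 hpA
    by_cases h5 : 5 ∣ t
    · have hA : A ∣ 6 := by simpa using hup' h5
      rw [Nat.gcd_eq_left h5]
      norm_num
      exact Nat.dvd_antisymm hA h6
    · have hcop : Nat.Coprime 5 t := (Nat.Prime.coprime_iff_not_dvd Nat.prime_five).mpr h5
      have h5A : 5 ∣ A := hcop.dvd_of_dvd_mul_right (dvd_trans (by norm_num) h15)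
      have h30 : 30 ∣ A := Nat.Coprime.mul_dvd_of_dvd_of_dvd (by norm_num) h6 h5A
      have hA : A ∣ 30 := by simpa using hup
      rw [Nat.Coprime.gcd_eq_one hcop]
      norm_num
      exact Nat.dvd_antisymm hA h30
  · have h4 : 4 ∣ A := by simpa using h1
    have h20 : 20 ∣ A := Nat.Coprime.mul_dvd_of_dvd_of_dvd (by norm_num) h4 hpA
    by_cases h3 : 3 ∣ t
    · have hA : A ∣ 20 := by simpa using hup' h3
      rw [Nat.gcd_eq_left h3]
      norm_num
      exact Nat.dvd_antisymm hA h20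
    · have hcop : Nat.Coprime 3 t := (Nat.Prime.coprime_iff_not_dvd Nat.prime_three).mpr h3
      have h3A : 3 ∣ A := hcop.dvd_of_dvd_mul_right (dvd_trans (by norm_num) h15)
      have h60 : 60 ∣ A := Nat.Coprime.mul_dvd_of_dvd_of_dvd (by norm_num) h20 h3A
      have hA : A ∣ 60 := by simpa using hup
      rw [Nat.Coprime.gcd_eq_one hcop]
      norm_num
      exact Nat.dvd_antisymm hA h60

/-- **THE EXACT WILD LOCAL TYPE AT A W2 PACKET: `e(K_{x₀}/ℚ_p) = p·(p − 1)·(p′/gcd(p′, t))·l`** at every fibre point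
`x₀ ∣ p ∈ {3, 5}` (`p ≠ l`, `{p, p′} = {3, 5}`) of the pilot datum of a genuine Θ-volume datum at `(ratPoint q₀, l)` over a pole of
`j(q₀)` of order `2t` with `p ∣ t` and `v_p((j(q₀)⁻¹p^{−2t})^{p−1} − 1) = 1` (the unit part of the Tate parameter is not a `p`-th
power mod `p²`). [cite: Serre1972, §1.11–§1.12] [cite: Mochizuki2012, IUTchI Ex. 3.2 (iv) p. 71; IUTchIV Thm. 1.10 p. 22]
[cite: SerreLocalFields1979, Ch. III §6 Prop. 13] [claim: Mochizuki2012, status: disputed] -/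
theorem GenuineK.absRamificationIdx_kOf_eq_wildUnit_ratPoint {q₀ : ℚ} {l : ℕ} (T : Cor22.ThetaVolumeDatumAt (ratPoint q₀) l)
    (pp : Nat.Primes) {p' : ℕ} (hpq : ((pp : ℕ) = 3 ∧ p' = 5) ∨ ((pp : ℕ) = 5 ∧ p' = 3)) (hpl : (pp : ℕ) ≠ l)
    {t : ℕ} (ht : 0 < t) (hpt : (pp : ℕ) ∣ t)
    (hpole : ∀ v : HeightOneSpectrum (𝓞 ℚ), Rat.HeightOneSpectrum.natGenerator v = pp →
      Literature.IUT.LogVolume.ord ℚ v (Cor22.jInv q₀) = -(2 * (t : ℤ)))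
    (hunit : padicValRat pp ((((Cor22.jInv q₀)⁻¹ / ((pp : ℕ) : ℚ) ^ (2 * t)) ^ ((pp : ℕ) - 1) - 1)) = 1) :
    letI := T.instFieldF; letI := T.instNumberFieldF; letI := T.instAlgebraF; letI := T.instFieldK
    letI := T.instNumberFieldK; letI := T.instAlgebraK; letI := T.instFieldFbar; letI := T.instAlgebraFbar
    letI := T.instAlgebraKFbar; letI := T.instIsElliptic
    haveI : Fact (pp : ℕ).Prime := ⟨pp.2⟩
    ∀ x₀ : (thetaIndex (pilotDataOfK T.D T.K)).Fibre (.inr pp),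
      absRamificationIdx (pp : ℕ) (kOf (pilotDataOfK T.D T.K) pp.1 x₀) = pp * (pp - 1) * (p' / Nat.gcd p' t) * l := by
  letI := T.instFieldF; letI := T.instNumberFieldF; letI := T.instAlgebraF; letI := T.instFieldK
  letI := T.instNumberFieldK; letI := T.instAlgebraK; letI := T.instFieldFbar; letI := T.instAlgebraFbar
  letI := T.instAlgebraKFbar; letI := T.instIsElliptic
  haveI : Fact (pp : ℕ).Prime := ⟨pp.2⟩
  have hp : (pp : ℕ).Prime := pp.2
  have hp2 : (pp : ℕ) ≠ 2 := by rcases hpq with ⟨h, -⟩ | ⟨h, -⟩ <;> omega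
  have hp30 : (pp : ℕ) ∣ 30 := by
    rcases hpq with ⟨h, -⟩ | ⟨h, -⟩
    · rw [h]; norm_num
    · rw [h]; norm_num
  haveI : IsGalois (ratPoint q₀).F T.F := (T.towerFacts T.inU).1
  have ht0 : (0 : ℤ) < t := by exact_mod_cast ht
  have hpole' : ∀ v : HeightOneSpectrum (𝓞 ℚ), Rat.HeightOneSpectrum.natGenerator v = pp →
      Literature.IUT.LogVolume.ord ℚ v (Cor22.jInv q₀) < 0 := fun v hv => by
    rw [hpole v hv]; linarith
  set X := pilotDataOfK T.D T.K with hXdef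
  intro x₀
  -- `e(K_{x₀}) = e(w | p)·l` and `p ∣ e(K_{x₀})`
  have hmul := GenuineK.absRamificationIdx_kOf_eq_mul_prime_ratPoint T pp hp2 hpl hpole' x₀
  have hpe := GenuineK.prime_dvd_absRamificationIdx_kOf_wildUnit_ratPoint T pp hp30 hp2 ht hpt hpole hunit x₀
  rw [hmul] at hpe ⊢
  set u := placeOf X pp.1 x₀ with hudef
  have hpu : ((pp : ℕ) : 𝓞 T.K) ∈ u.asIdeal := natCast_mem_placeOf X pp.1 x₀
  set w := finBelow T.F T.K u with hwdef
  have hw : ((pp : ℕ) : 𝓞 T.F) ∈ w.asIdeal := by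
    rw [Cor22.natCast_mem_asIdeal_iff_residueChar_eq _ pp.2, hwdef, residueChar_finBelow]
    exact residueChar_eq_of_natCast_mem pp.1 hpu
  -- `p ∣ e(w | p)` (`p ≠ l` prime)
  have hpA : (pp : ℕ) ∣ w.asIdeal.ramificationIdx ℤ := by
    have hcop : Nat.Coprime (pp : ℕ) l :=
      (Nat.coprime_primes pp.2 T.D.l_prime).mpr hpl
    exact hcop.dvd_of_dvd_mul_right hpe
  -- the place `v₀` of `ℚ` under `w` is `p`
  set v₀ : HeightOneSpectrum (𝓞 ℚ) := finBelow (ratPoint q₀).F T.F w with hv₀def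
  have hchar : residueChar ℚ v₀ = pp := by
    rw [hv₀def]
    change residueChar (ratPoint q₀).F (finBelow (ratPoint q₀).F T.F w) = pp
    rw [residueChar_finBelow]
    exact residueChar_eq_of_natCast_mem (pp : ℕ) hw
  have hpv : ((pp : ℕ) : 𝓞 ℚ) ∈ v₀.asIdeal := (Cor22.natCast_mem_asIdeal_iff_residueChar_eq v₀ hp).2 hchar
  have hvp : Rat.HeightOneSpectrum.natGenerator v₀ = pp := by
    have hdvd := (UniformABCConjecture.natCast_mem_asIdeal_iff v₀ pp).1 hpv
    exact (Nat.prime_dvd_prime_iff_eq (Rat.HeightOneSpectrum.prime_natGenerator v₀) hp).1 hdvd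
  have hord := hpole v₀ hvp
  have hbad : v₀ ∈ Cor22.badPlaces (ratPoint q₀) :=
    (Cor22.mem_badPlaces_iff_ord_neg (ratPoint q₀) v₀).2 (by
      show Literature.IUT.LogVolume.ord ℚ v₀ (Cor22.jInv q₀) < 0
      rw [hord]; linarith)
  have hp1 : Literature.IUT.LogVolume.ord ℚ v₀ ((pp : ℕ) : ℚ) = 1 := by
    rw [← hvp]
    exact Cor22.ord_natGenerator_eq_one v₀
  -- `e(w | p) = e(w | v₀)` over `ℚ`
  have hew : w.asIdeal.ramificationIdx ℤ = w.asIdeal.ramificationIdx (𝓞 (ratPoint q₀).F) := by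
    haveI : (finBelow (ratPoint q₀).F T.F w).asIdeal.IsMaximal := (finBelow (ratPoint q₀).F T.F w).isMaximal
    have h1 : ramIdx (ratPoint q₀).F (w.under (𝓞 (ratPoint q₀).F)) = 1 := by
      rw [ramIdx_eq]
      exact Literature.NumberTheory.EllipticCurves.Fisher2016.ramificationIdx_int_rat_eq_one _
    rw [ThetaData.absRamificationIdx_eq_ramIdx_mul (F := (ratPoint q₀).F) w]
    erw [h1, one_mul]
    exact Ideal.ramificationIdx'_eq_ramificationIdx (finBelow (ratPoint q₀).F T.F w).asIdeal w.asIdeal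
      (finBelow (ratPoint q₀).F T.F w).ne_bot
  -- UPPER: `e(w | v₀) ∣ p(p−1)p′`, and `∣ p(p−1)` when `p′ ∣ t`
  have hup : w.asIdeal.ramificationIdx (𝓞 (ratPoint q₀).F) ∣ pp * (pp - 1) * p' :=
    Cor22.ramificationIdx_subThetaField_dvd_wild T.F T.inU T.isSubThetaField w hbad hpq hpv hp1
  have hup' : p' ∣ t → w.asIdeal.ramificationIdx (𝓞 (ratPoint q₀).F) ∣ pp * (pp - 1) := fun hqt =>
    Cor22.ramificationIdx_subThetaField_dvd_wild_of_dvd_ord T.F T.inU T.isSubThetaField w hbad hpq hpv hp1 (by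
      show ((p' : ℕ) : ℤ) ∣ Literature.IUT.LogVolume.ord ℚ v₀ (Cor22.jInv q₀)
      rw [hord, dvd_neg]
      exact dvd_mul_of_dvd_right (Int.natCast_dvd_natCast.mpr hqt) 2)
  -- LOWER: `(p − 1) ∣ e(w | p)`, `p ∣ e(w | p)` and `15 ∣ e(w | v₀)·t`
  have h1 : (pp - 1 : ℕ) ∣ w.asIdeal.ramificationIdx (𝓞 (ratPoint q₀).F) := by
    rw [← hew]
    exact T.sub_one_dvd_ramificationIdx_int hp hp30 w hw
  have h15 : 15 ∣ w.asIdeal.ramificationIdx (𝓞 (ratPoint q₀).F) * t :=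
    T.fifteen_dvd_ramificationIdx_mul w (by rw [← hv₀def]; exact hord) ht
  rw [hew] at hpA
  rw [hew, wild_index_eq' hpq hpA h1 h15 hup hup']

end Summit.ABC.IUTFork.Conditional

end
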